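import Mathlib.RingTheory.KrullDimension.Regular
import Mathlib.RingTheory.Regular.RegularSequence
import Literature.AlgebraicGeometry.Resolution.CohenMacaulayUnmixed
import Literature.RingTheory.TightClosure.TightClosure
import Summits.ResolutionOfSingularities.ResolutionOfSingularities.Theorems.FrobeniusLadderFRationalModificationSopWeaklyRegular
import Summits.ResolutionOfSingularities.ResolutionOfSingularities.Theorems.FrobeniusLadderFInjectiveMacaulayficationOneParameterIdeal
import HarnessLib

/-!
# Deformation of "Cohen–Macaulay and F-injective" (Fedder 1983, Thm. 3.4 (1))

Support file for crux stmt-ResolutionOfSingularities-15315 (`FrobeniusLadder.FInjectiveMacaulayfication`,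
line `Sketch`, helper stub `cmfi_of_cmfi_quotient`). The per-stalk clause of the crux reads: every
system of parameters (`d = dim` elements generating an ideal with maximal radical) is a weakly regular
sequence, AND every such parameter ideal is Frobenius closed
(`y^(p^e) ∈ ((s)^[p^e]) ⇒ y ∈ (s)`) — i.e. Cohen–Macaulay + F-injective, in the ideal-theoretic form of
Fedder. **This clause deforms**: if `(R, 𝔪)` is a Noetherian local ring of prime characteristic `p`,
`x ∈ 𝔪` is a non-zero-divisor and `R/xR` satisfies the clause, then `R` satisfies the clause
(`cmfi_of_cmfi_quotient`; Fedder 1983, Thm. 3.4 (1), Cohen–Macaulay case). This is how a modification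
engine certifies the clause at a new point from an exceptional divisor / a normal cone.

Proof. `dim R = dim R/xR + 1 =: m + 1`. Pick a system of parameters `t'` of `R/xR` and lift it to
`t : Fin m → R`. By hypothesis `t'` is weakly regular on `R/xR`, so `x :: t` is an `R`-regular
sequence in `𝔪` of length `dim R`: `R` is Cohen–Macaulay, hence EVERY system of parameters of `R` is
weakly regular (`FRationalModification.SopWeaklyRegular.stub_sopWeaklyRegular`, Matsumura 17.4). The
system of parameters `u = (x, t)` of `R` generates a Frobenius closed ideal: if `y^q ∈ (u)^[q]` then
modulo `x`, `ȳ^q ∈ (t')^[q]`, so `ȳ ∈ (t')` and `y ∈ (t) + (x) = (u)`. Finally ONE Frobenius closed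
parameter ideal in a Cohen–Macaulay local ring makes all of them Frobenius closed
(`FInjectiveMacaulayfication.OneSop.isFrobeniusClosed_of_isFrobeniusClosed_sop`).

## References

* [Fedder1983] R. Fedder, *F-purity and rational singularity*, Trans. Amer. Math. Soc. 278 (1983)
  461–480, Thm. 3.4 (1).
-/

-- single-problem summit: the doubled namespace component `ResolutionOfSingularities` is forced
set_option linter.dupNamespace false

namespace Summit.ResolutionOfSingularities.ResolutionOfSingularities.Theorems.FInjectiveMacaulayfication.Deformation

open IsLocalRing RingTheory.Sequence Literature.RingTheory.TightClosure
  Literature.AlgebraicGeometry.Resolution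
open scoped Pointwise

/-- **Frobenius-closedness lifts modulo an element of the ideal.** Let `I ≤ J` be ideals of `R` and
suppose the image of `J` in `R/I` is Frobenius closed in the inline sense
(`ȳ^(p^e) ∈ ((J̄)^[p^e]) ⇒ ȳ ∈ J̄`). Then `J` is Frobenius closed in `R` in the inline sense: reduce
`y^(p^e) ∈ (J^[p^e])` modulo `I` and pull `ȳ ∈ J̄` back along `I ≤ J`. [folklore] -/
theorem frobeniusClosed_inline_of_quotient {R : Type*} [CommRing R] (p : ℕ) {I J : Ideal R}
    (hIJ : I ≤ J)
    (h : ∀ y : R ⧸ I, (∃ e : ℕ, y ^ p ^ e ∈ Ideal.span ((fun z : R ⧸ I => z ^ p ^ e) ''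
      (J.map (Ideal.Quotient.mk I) : Set (R ⧸ I)))) → y ∈ J.map (Ideal.Quotient.mk I)) :
    ∀ y : R, (∃ e : ℕ, y ^ p ^ e ∈ Ideal.span ((fun z : R => z ^ p ^ e) '' (J : Set R))) →
      y ∈ J := by
  rintro y ⟨e, hy⟩
  refine (Ideal.mem_quotient_iff_mem hIJ).mp (h _ ⟨e, ?_⟩)
  have h1 := Ideal.mem_map_of_mem (Ideal.Quotient.mk I) hy
  rw [map_pow, Ideal.map_span] at h1
  refine Ideal.span_mono ?_ h1
  rintro _ ⟨_, ⟨z, hz, rfl⟩, rfl⟩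
  exact ⟨Ideal.Quotient.mk I z, Ideal.mem_map_of_mem _ hz, (map_pow _ z _).symm⟩

/-- **The radical of an ideal is maximal if it is so modulo a smaller ideal.** For `I ≤ J`, if the
image of `J` in `R/I` has radical the maximal ideal of the local ring `R/I`, then `rad J = 𝔪`.
[folklore] -/
theorem radical_eq_maximalIdeal_of_quotient {R : Type*} [CommRing R] [IsLocalRing R] {I J : Ideal R}
    (hIJ : I ≤ J) [IsLocalRing (R ⧸ I)]
    (h : (J.map (Ideal.Quotient.mk I)).radical = maximalIdeal (R ⧸ I)) :
    J.radical = maximalIdeal R := by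
  have hker : RingHom.ker (Ideal.Quotient.mk I) ≤ J := by rw [Ideal.mk_ker]; exact hIJ
  rw [← Ideal.map_radical_of_surjective Ideal.Quotient.mk_surjective hker] at h
  have h2 := congrArg (Ideal.comap (Ideal.Quotient.mk I)) h
  rw [Ideal.comap_map_mk (hIJ.trans Ideal.le_radical)] at h2
  rw [h2]
  exact eq_maximalIdeal (Ideal.comap_isMaximal_of_surjective _ Ideal.Quotient.mk_surjective)

/-- **Deformation of "Cohen–Macaulay + F-injective" (Fedder 1983, Thm. 3.4 (1), Cohen–Macaulay
case).** Let `(R, 𝔪)` be a Noetherian local ring of prime characteristic `p` and `x ∈ 𝔪` a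
non-zero-divisor. If `R/xR` satisfies the per-stalk clause of crux `FInjectiveMacaulayfication` — every
system of parameters (`d = dim` elements, radical maximal) is a weakly regular sequence and generates a
Frobenius closed ideal (`y^(p^e) ∈ ((s)^[p^e]) ⇒ y ∈ (s)`) — then so does `R`. Proof: `R` is
Cohen–Macaulay (`x ::` a lifted system of parameters of `R/xR` is a maximal regular sequence, then
Matsumura 17.4), the lifted parameter ideal `(x, t)` is Frobenius closed (reduce modulo `x`), and one
Frobenius closed parameter ideal makes all of them Frobenius closed. [cite: Fedder1983, Thm. 3.4 (1)] -/
theorem cmfi_of_cmfi_quotient : ∀ (p : ℕ) [Fact p.Prime] (R : Type) [CommRing R] [IsNoetherianRing R] [IsLocalRing R] [CharP R p] (x : R), x ∈ IsLocalRing.maximalIdeal R → x ∈ nonZeroDivisors R → (∀ d : ℕ, ringKrullDim (R ⧸ Ideal.span {x}) = d → ∀ s : Fin d → R ⧸ Ideal.span {x}, (Ideal.span (Set.range s)).radical.IsMaximal → RingTheory.Sequence.IsWeaklyRegular (R ⧸ Ideal.span {x}) (List.ofFn s) ∧ ∀ y : R ⧸ Ideal.span {x}, (∃ e : ℕ, y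 ^ p ^ e ∈ Ideal.span ((fun z : R ⧸ Ideal.span {x} => z ^ p ^ e) '' (Ideal.span (Set.range s) : Set (R ⧸ Ideal.span {x})))) → y ∈ Ideal.span (Set.range s)) → ∀ d : ℕ, ringKrullDim R = d → ∀ s : Fin d → R, (Ideal.span (Set.range s)).radical.IsMaximal → RingTheory.Sequence.IsWeaklyRegular R (List.ofFn s) ∧ ∀ y : R, (∃ e : ℕ, y ^ p ^ e ∈ Ideal.span ((fun z : R => z ^ p ^ e) '' (Ideal.span (Set.range s) : Set R))) → y ∈ Ideal.span (Set.range s) := by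
  intro p _ R _ _ _ _ x hxm hx0 hquot d hd s hsrad
  -- (0) the local ring `R̄ = R/xR`
  obtain ⟨hnt, hloc⟩ := isLocalRing_quotient_span_singleton hxm
  set Rb := R ⧸ Ideal.span {x}
  set mk := Ideal.Quotient.mk (Ideal.span {x})
  have hxreg : IsSMulRegular R x :=
    (isRegular_iff_mem_nonZeroDivisors.mpr hx0).left.isSMulRegular
  have hxle : Ideal.span {x} ≤ maximalIdeal R := (Ideal.span_singleton_le_iff_mem _).mpr hxm
  have hmaxb : maximalIdeal Rb = (maximalIdeal R).map mk :=
    (map_maximalIdeal_of_surjective mk Ideal.Quotient.mk_surjective).symm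
  -- (1) `dim R = dim R̄ + 1 = m + 1 = d`
  obtain ⟨m, hm⟩ := exists_nat_cast_eq_ringKrullDim (R := Rb)
  have hdimR : ringKrullDim R = ((m + 1 : ℕ) : WithBot ℕ∞) := by
    rw [Nat.cast_succ, ← hm]
    exact (ringKrullDim_quotient_span_singleton_succ_eq_ringKrullDim hxreg hxm).symm
  have hdm : d = m + 1 := by
    have h := hd.symm.trans hdimR
    exact_mod_cast h
  subst hdm
  -- (2) a system of parameters `t'` of `R̄`: weakly regular, `(t')` Frobenius closed
  obtain ⟨t', ht'⟩ := exists_isSystemOfParameters (R := Rb) hm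
  obtain ⟨hw₀, hfc₀⟩ := hquot m hm t' (isSystemOfParameters_iff.mp ht').2
  -- (3) lift `t'` to `t : Fin m → R`; `x :: t` is a maximal `R`-regular sequence in `𝔪`
  choose t ht using fun i => Ideal.Quotient.mk_surjective (t' i)
  have htm : ∀ i, t i ∈ maximalIdeal R := by
    intro i
    refine (Ideal.mem_quotient_iff_mem hxle).mp ?_
    rw [← hmaxb, ht i, ← ht'.2]
    exact Ideal.le_radical (Ideal.subset_span ⟨i, rfl⟩)
  have hlist : (List.ofFn t).map mk = List.ofFn t' := by
    rw [List.map_ofFn]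
    exact congrArg List.ofFn (funext ht)
  have hw₁ : IsWeaklyRegular Rb (List.ofFn t) := by
    have h := (isWeaklyRegular_map_algebraMap_iff Rb Rb (List.ofFn t)).mp
    rw [Ideal.Quotient.algebraMap_eq, hlist] at h
    exact h hw₀
  have heq : (x • (⊤ : Submodule R R)) = Ideal.span {x} := by
    rw [← Submodule.ideal_span_singleton_smul, smul_eq_mul, Ideal.mul_top]
  let e : QuotSMulTop x R ≃ₗ[R] Rb := Submodule.quotEquivOfEq _ _ heq
  have hw₂ : IsWeaklyRegular (QuotSMulTop x R) (List.ofFn t) := (e.isWeaklyRegular_congr _).mpr hw₁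
  have hmem : ∀ r ∈ x :: List.ofFn t, r ∈ maximalIdeal R := by
    intro r hr
    rcases List.mem_cons.mp hr with rfl | hr
    · exact hxm
    · obtain ⟨i, rfl⟩ := List.mem_ofFn.mp hr
      exact htm i
  have hreg : IsRegular R (x :: List.ofFn t) :=
    IsRegular.of_isWeaklyRegular_of_mem_maximalIdeal R hmem (IsWeaklyRegular.cons hxreg hw₂)
  -- hence `R` is Cohen–Macaulay: every system of parameters is weakly regular
  have hCM : ∀ ⦃n : ℕ⦄ (s : Fin n → R), IsSystemOfParameters s → IsWeaklyRegular R (List.ofFn s) :=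
    FRationalModification.SopWeaklyRegular.stub_sopWeaklyRegular
      ⟨x :: List.ofFn t, hreg, hmem, by rw [List.length_cons, List.length_ofFn, hdimR]⟩
  -- (4) the system of parameters `u = (x, t)` of `R` generates a Frobenius closed ideal
  set u : Fin (m + 1) → R := Fin.cons x t with hu_def
  have hrange : Set.range u = insert x (Set.range t) := Fin.range_cons x t
  set J : Ideal R := Ideal.span (Set.range u) with hJ_def
  have hxJ : Ideal.span {x} ≤ J := by
    rw [Ideal.span_singleton_le_iff_mem, hJ_def, hrange]
    exact Ideal.subset_span (Set.mem_insert x _)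
  have hmapJ : J.map mk = Ideal.span (Set.range t') := by
    have h0 : mk x = 0 := Ideal.Quotient.eq_zero_iff_mem.mpr (Ideal.mem_span_singleton_self x)
    have hcomp : mk ∘ t = t' := funext ht
    rw [hJ_def, hrange, Ideal.map_span, Set.image_insert_eq, ← Set.range_comp, h0, hcomp,
      Ideal.span_insert_zero]
  have hu : IsSystemOfParameters u :=
    ⟨hdimR, radical_eq_maximalIdeal_of_quotient hxJ (by rw [hmapJ]; exact ht'.2)⟩
  have hJfc : IsFrobeniusClosed p J :=
    (isFrobeniusClosed_iff p).mpr
      (frobeniusClosed_inline_of_quotient p hxJ (by rw [hmapJ]; exact hfc₀))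
  -- (5) one Frobenius closed parameter ideal ⇒ all (Cohen–Macaulay)
  have hs : IsSystemOfParameters s := isSystemOfParameters_iff.mpr ⟨hd, hsrad⟩
  exact ⟨hCM s hs, (isFrobeniusClosed_iff p).mp
    (OneSop.isFrobeniusClosed_of_isFrobeniusClosed_sop p hCM hu hs hJfc)⟩

end Summit.ResolutionOfSingularities.ResolutionOfSingularities.Theorems.FInjectiveMacaulayfication.Deformation
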